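import Summits.Parity.GeneralizedHardyLittlewood.Theses.ParityWeightedChenSwitching

/-!
# Disproof of `ParityChenInequality` (stmt-Parity-18666) — findings: SURVIVES birth vetting (refuter-rattack, 2026-08-17)

Crux S1 of route `ParityWeightedChenSwitching`:
`∃ c > 0, ∃ C, ∀ᶠ x, c·x/log²x − C·(E₁ x + E₂ x) ≤ π₂ x`, with `E₁, E₂` literally the K1/K2 sums.

## Findings (all theorems below are sorry-free)

1. **Elaborates** (rc 0); parse read back: `c * x / Real.log x ^ 2 = (c*x)/((log x)^2)`; `Nat.primesLE x`
   = primes `≤ x` (Mathlib); `chenSetB x` = the image-Finset `{p₁p₂p₃ − 2}` (values, no multiplicity);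
   `p = 2` contributes `μ(4) = 0`, so `E₁` equals the Möbius remainder of `twinSieveSet x` exactly.
2. **Not trivial**: `simp`, `norm_num`, `aesop`, `exact?` fail (Scratch.lean in the seat folder).
3. **Strength sandwich** (the load-bearing analysis — S1 has no hypotheses to drop):
   * `parityChen_of_twinLowerDensity` : `T → S1` (`C = 0`); hence informally `GHL → T → S1` (S → C), so an
     unconditional `¬S1` would refute positive lower HL-density of twin primes (`not_twinLowerDensity_of_not_parityChen`).
   * `parityChen_of_bigE` : `(∃ ε>0, ∀ᶠ x, ε·x/log²x ≤ E₁+E₂) → S1` trivially (`π₂ ≥ 0`): S1 is trivially TRUE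
     in any world where K1 ∧ K2 fail strongly; heuristically `E₁ ≈ 0.3·2√(π(x)·x^0.499) ≍ x^{3/4}` (square-root
     cancellation; measured E₁/(x/log²x) = 1.90, 1.54, 0.96 at x = 10⁴, 10⁵, 10⁶), so BigE is not provable and
     S1 is not trivial for that reason either.
   * `twinLowerDensity_of_K1_K2_S1`, `parityChen_iff_twinLowerDensity_of_K1_K2` : given K1 ∧ K2, `S1 ↔ T`.
   * `parityChen_iff_nonnegC` : WLOG `0 ≤ C` (negative `C` only strengthens; the ∃ is harmless).
4. **C → S probe**: S1 alone does not give GHL or T (it is implied by T and by BigE); it does not restate the summit.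
5. **Paper check of the planner's 5-stub skeleton** (stub signatures from the item record): with the parity weight
   `u = (1 − μ)/2 ≥ 0` on `𝒜(x)` and on `chenSetB x`, the u-weighted sequences are `SieveSequence`s with size `X/2`,
   density `1/φ`, remainders `R^u_d = ½ r_d − ½ M_d` (`M_d` = the inner sums of K1/K2), so the tree's
   `Iwaniec1980_thm1_lower/upper_holds` (nonnegative real weights, remainder form) apply verbatim; the `(q,d) ↦ qd`
   injection (q the unique prime factor in `[z,y)`) keeps the Σ_q twisted remainders inside `E₁`; on u-weighted
   squarefree survivors Chen's weight `1 − ½ρ₁ − ½ρ₂ > 0` forces `Ω ≤ 2`, and `u = 0` at `Ω = 2`, so the weighted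
   count is `≤ π₂(x) + 2(x+2)/(z−1)`; ALL THREE main terms halve (u ≡ 1 on `p₁p₂p₃`, but the B-side bound goes through
   `#{e ∈ B prime, e ≥ y} ≤ S_u(B, y)`), so the margin is exactly ½ × Chen's margin at levels (0.499, 0.499):
   numerically `e^γ(0.274535 − 0.224838 − 0.125251·c_sw)` = +0.003147·e^γ with the tree majorant
   `c_sw ≤ 0.371654`, +0.004220·e^γ at the true `c_sw = 0.363084`, −0.001088·e^γ with only `switchingIntegral_lt`
   (verified independently, Simpson n = 2·10⁵). `stub_numerics` is a TRUE closed-form inequality (e^γ factors out;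
   threshold c* = 0.39678). No stub found false or misstated.
6. **Verdict**: survives; theorem-grade as classified (difficulty L: weighted-sequence bookkeeping over PROVED tree
   sieve infrastructure). No refutation is possible without disproving `TwinLowerDensity`.
-/

namespace Summit.Parity.GeneralizedHardyLittlewood.Cruxes.ParityChenInequality.Disproof

open Filter Asymptotics
open Summit.Parity.GeneralizedHardyLittlewood.Theses.ParityWeightedChenSwitching

open scoped Classical in
/-- `E₁(x)`: the K1 sum. -/
noncomputable def E1 (x : ℕ) : ℝ :=
  ∑ m ∈ Finset.Icc 1 ⌊(x : ℝ) ^ (0.499 : ℝ)⌋₊,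
    |∑ p ∈ (Nat.primesLE x).filter (fun p => m ∣ p + 2), (ArithmeticFunction.moebius (p + 2) : ℝ)|

open scoped Classical in
/-- `E₂(x)`: the K2 sum. -/
noncomputable def E2 (x : ℕ) : ℝ :=
  ∑ m ∈ Finset.Icc 1 ⌊(x : ℝ) ^ (0.499 : ℝ)⌋₊,
    |∑ e ∈ (Literature.NumberTheory.Sieve.Chen.chenSetB x).filter (fun e => m ∣ e),
      (ArithmeticFunction.moebius e : ℝ)|

open scoped Classical in
/-- `π₂(x)` as typed in the route. -/
noncomputable def pi2 (x : ℕ) : ℝ :=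
  (((Finset.range (x + 1)).filter (fun p => p.Prime ∧ (p + 2).Prime)).card : ℝ)

theorem E1_nonneg (x : ℕ) : 0 ≤ E1 x := Finset.sum_nonneg fun _ _ => abs_nonneg _
theorem E2_nonneg (x : ℕ) : 0 ≤ E2 x := Finset.sum_nonneg fun _ _ => abs_nonneg _
theorem pi2_nonneg (x : ℕ) : 0 ≤ pi2 x := Nat.cast_nonneg _

/-- Unfolding: the crux in `E1/E2/pi2` vocabulary. -/
theorem parityChen_iff :
    ParityChenInequality ↔ ∃ c : ℝ, 0 < c ∧ ∃ C : ℝ, ∀ᶠ x : ℕ in atTop,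
      c * (x : ℝ) / Real.log x ^ 2 - C * (E1 x + E2 x) ≤ pi2 x := Iff.rfl

/-- T in the same vocabulary. -/
theorem twinLowerDensity_iff :
    TwinLowerDensity ↔ ∃ c : ℝ, 0 < c ∧ ∃ x₀ : ℕ, ∀ x : ℕ, x₀ ≤ x →
      c * (x : ℝ) / Real.log x ^ 2 ≤ pi2 x := Iff.rfl

/-- **T → S1** (`C = 0`): the crux is no stronger than the support node `TwinLowerDensity`. -/
theorem parityChen_of_twinLowerDensity (hT : TwinLowerDensity) : ParityChenInequality := by
  rw [twinLowerDensity_iff] at hT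
  rw [parityChen_iff]
  obtain ⟨c, hc, x₀, hx₀⟩ := hT
  refine ⟨c, hc, 0, ?_⟩
  filter_upwards [eventually_ge_atTop x₀] with x hx
  have := hx₀ x hx
  simp only [zero_mul, sub_zero]
  exact this

/-- **Big E → S1 trivially**: if `E₁ + E₂ ≫ x/log²x` eventually (strong failure of K1 ∧ K2), the crux
holds with `c = ε`, `C = 1` because `π₂ ≥ 0`. -/
theorem parityChen_of_bigE
    (hE : ∃ ε : ℝ, 0 < ε ∧ ∀ᶠ x : ℕ in atTop, ε * (x : ℝ) / Real.log x ^ 2 ≤ E1 x + E2 x) :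
    ParityChenInequality := by
  rw [parityChen_iff]
  obtain ⟨ε, hε, hev⟩ := hE
  refine ⟨ε, hε, 1, ?_⟩
  filter_upwards [hev] with x hx
  have := pi2_nonneg x
  linarith

/-- **Sandwich**: an unconditional `¬S1` would DISPROVE positive lower density of twin primes and
would prove `E₁ + E₂` is NOT eventually `≥ ε x/log²x` for any `ε > 0`. -/
theorem not_twinLowerDensity_of_not_parityChen (h : ¬ ParityChenInequality) :
    ¬ TwinLowerDensity ∧
      ¬ ∃ ε : ℝ, 0 < ε ∧ ∀ᶠ x : ℕ in atTop, ε * (x : ℝ) / Real.log x ^ 2 ≤ E1 x + E2 x :=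
  ⟨fun hT => h (parityChen_of_twinLowerDensity hT), fun hE => h (parityChen_of_bigE hE)⟩

/-- **WLOG `0 ≤ C`** (since `E₁ + E₂ ≥ 0`). -/
theorem parityChen_iff_nonnegC :
    ParityChenInequality ↔ ∃ c : ℝ, 0 < c ∧ ∃ C : ℝ, 0 ≤ C ∧ ∀ᶠ x : ℕ in atTop,
      c * (x : ℝ) / Real.log x ^ 2 - C * (E1 x + E2 x) ≤ pi2 x := by
  rw [parityChen_iff]
  constructor
  · rintro ⟨c, hc, C, hev⟩
    refine ⟨c, hc, max C 0, le_max_right _ _, ?_⟩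
    filter_upwards [hev] with x hx
    have hE : 0 ≤ E1 x + E2 x := add_nonneg (E1_nonneg x) (E2_nonneg x)
    have hCE : C * (E1 x + E2 x) ≤ max C 0 * (E1 x + E2 x) :=
      mul_le_mul_of_nonneg_right (le_max_left _ _) hE
    linarith
  · rintro ⟨c, hc, C, -, hev⟩
    exact ⟨c, hc, C, hev⟩

/-- **K1 → K2 → S1 → T** (the glue inside `closes`, restated standalone). -/
theorem twinLowerDensity_of_K1_K2_S1 (h₁ : MoebiusShiftedPrimesLevel) (h₂ : MoebiusSwitchedHostLevel)
    (h₃ : ParityChenInequality) : TwinLowerDensity := by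
  obtain ⟨c, hc, C, hev⟩ := h₃
  have ho := ((h₁.add h₂).const_mul_left C).def (half_pos hc)
  obtain ⟨x₀, hx₀⟩ := Filter.eventually_atTop.mp ((hev.and ho).and (Filter.eventually_ge_atTop 2))
  refine ⟨c / 2, half_pos hc, x₀, fun x hx => ?_⟩
  obtain ⟨⟨hin, hsm⟩, hx2⟩ := hx₀ x hx
  have hx1 : (1 : ℝ) < x := by exact_mod_cast (show 1 < x by omega)
  have hlog : 0 < Real.log x := Real.log_pos hx1
  set g : ℝ := (x : ℝ) / Real.log x ^ 2 with hg_def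
  have hg : 0 ≤ g := by positivity
  rw [Real.norm_eq_abs, Real.norm_eq_abs, abs_of_nonneg hg] at hsm
  have h5 := (abs_le.mp hsm).2
  have e1 : c * (x : ℝ) / Real.log x ^ 2 = c * g := by rw [hg_def]; ring
  have e2 : c / 2 * (x : ℝ) / Real.log x ^ 2 = c / 2 * g := by rw [hg_def]; ring
  rw [e1] at hin
  rw [e2]
  -- buildfix 2026-08-19: `TwinLowerDensity` is now stated with `Literature.NumberTheory.Sieve.twinPrimeCount`
  -- (definitionally the same filtered `Finset.range` cardinality as in the crux); expose it for `linarith`.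
  unfold Literature.NumberTheory.Sieve.twinPrimeCount
  linarith

/-- Given K1 ∧ K2, the crux is EQUIVALENT to the support node T. -/
theorem parityChen_iff_twinLowerDensity_of_K1_K2 (h₁ : MoebiusShiftedPrimesLevel)
    (h₂ : MoebiusSwitchedHostLevel) : ParityChenInequality ↔ TwinLowerDensity :=
  ⟨twinLowerDensity_of_K1_K2_S1 h₁ h₂, parityChen_of_twinLowerDensity⟩

end Summit.Parity.GeneralizedHardyLittlewood.Cruxes.ParityChenInequality.Disproof
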